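import Summits.BirchSwinnertonDyer.Rank1Residual.Additive.TameBranchLower
import Summits.BirchSwinnertonDyer.Rank1Residual.Additive.CensusX43TwistSqueeze
import Literature.NumberTheory.EllipticCurves.PAdicLFunctionInterpolationProofs
import HarnessLib

/-!
# Class N10, tame branch: the WILD additive character `ψ_κ` of a primitive character mod `p^m`,
# the Gauss-sum identity `τ(ε,ψ_κ)·τ(ε̄,ψ_κ) = ε(−1)·p`, and UN-TWISTING the wild symbol sum of
# `x = τ_{χ⁻¹}Φ` (cell `b2b-bsdres`, lane CLASS-CLOSURE, seat cc-typer-2; team n1011 lead R5-10: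
# the bridge `HasOrdinaryTwistPartner ⟹ IsTameBranchOf`, support file 1 of 2)

HONEST FRAMING (cell `b2b-bsdres`, run/shared/lean/b2b/bsd-rank1-residual/, verbatim in every
file): the goal of the cell is to DELETE the COMBINATION-SHAPED residual classes of the
Birch–Swinnerton-Dyer formula for ALL analytic-rank `≤ 1` elliptic curves over `ℚ` — "full BSD
formula for every rank `≤ 1` curve in class `C`" assembled STRICTLY from published theorems — so
that the rank-`≤ 1` remainder becomes exactly the CONSTRUCTION-SHAPED classes, which are TYPED
(missing-input `Prop`s), NOT attempted. This is not "finishing BSD". Lane CLASS-CLOSURE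
(coordinator ruling 2026-08-21T04:07Z): research routes, no claim beyond the stated classes;
census output = EVIDENCE / conjecture items with held-out validation, NEVER a Literature fact;
the class N10 stays CONSTRUCTION-shaped (RESIDUAL-MAP §I); NOTHING is booked. THEOREMS ONLY plus ONE
auxiliary definition (an additive character written out as data); no named fact, no conjecture node.

## What (support for `Additive/TameBranchOfTwistPartner.lean`)

`TameBranchLower.lean` typed the E-normalised `ε̄`-branch `IsTameBranchOf f p ε α B` through the
INTRINSIC Gauss sum `tameGaussSum p ε κ = ∑_{t mod p} ε(t) κ(1 + t p^{m−1})`. Here: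
* §1 `wildAddChar hm κ : AddChar (ℤ/p) ℂ_p`, `t ↦ κ(1 + t·p^{m−1})` (`m ≥ 2`; additive because
  `(p^{m−1})² ≡ 0`), so that `tameGaussSum p ε κ = gaussSum ε (wildAddChar hm κ)` DEFINITIONALLY;
  `ψ_κ ≠ 1` for `κ` PRIMITIVE (else `κ` is trivial on `ker((ℤ/p^m)ˣ → (ℤ/p^{m−1})ˣ) = {1 + y p^{m−1}}`
  and factors through `p^{m−1}`, against `not_factorsThrough_of_isPrimitive`), hence PRIMITIVE on the
  field `ℤ/p`, and Mathlib's `gaussSum_mul_gaussSum_eq_card` gives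
  `τ(ε,ψ_κ) τ(ε⁻¹,ψ_κ) = ε(−1) p` (`tameGaussSum_mul_tameGaussSum_inv`).
* §2 `sum_mul_twist_eq`: for `x = τ_{χ⁻¹}Φ` (`x(s) = ∑_c χ̄(c) Φ(s + c/p)`, `Φ` `1`-periodic — the
  census's `CensusX43.HasOrdinaryTwistPartner` shape) and ANY Dirichlet character `κ` mod `p^m`,
  `m ≥ 2`: `∑_b κ(b) x(b/p^m) = ε(−1) τ(ε̄,ψ_κ) ∑_a κ(a) ε̄(a) Φ(a/p^m)` (`ε = ι∘χ`): substitute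
  `a = b + c p^{m−1}`, `κ(a − c p^{m−1}) = κ(a) ψ_κ(−c/a)` on units, `gaussSum_mulShift_eq`.
This is the finite Fourier analysis behind "the `ε̄`-branch of `μ_g` is E-intrinsic"
(`TameBranchLower.lean`, module docstring (★)); Mazur–Tate–Teitelbaum, Invent. Math. 84 (1986)
§I.8 (twisting operator) [MazurTateTeitelbaum1986Invent]. Pure algebra over `ℤ/p^m`; nothing booked.
-/

noncomputable section

open scoped Classical

namespace Summit.BirchSwinnertonDyer.Rank1Residual.Additive

open Literature.NumberTheory.EllipticCurves

/-! ### §1 Arithmetic of `ℤ/p^m` at the top step and the wild additive character -/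

section WildLevel

variable {p : ℕ} [hp : Fact p.Prime] {m : ℕ}

omit hp in
/-- `p · p^{m-1} = 0` in `ℤ/p^m` (`1 ≤ m`). -/
theorem natCast_mul_pow_pred_eq_zero (hm : 1 ≤ m) :
    (p : ZMod (p ^ m)) * (p : ZMod (p ^ m)) ^ (m - 1) = 0 := by
  rw [← pow_succ', Nat.sub_add_cancel hm, ← Nat.cast_pow, ZMod.natCast_self]

omit hp in
/-- `(p^{m-1})² = 0` in `ℤ/p^m` (`2 ≤ m`). -/
theorem pow_pred_mul_pow_pred_eq_zero (hm : 2 ≤ m) :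
    (p : ZMod (p ^ m)) ^ (m - 1) * (p : ZMod (p ^ m)) ^ (m - 1) = 0 := by
  rw [← pow_add, ← Nat.cast_pow, ZMod.natCast_eq_zero_iff]
  exact pow_dvd_pow p (by omega)

/-- Classes with the same residue mod `p` have the same multiple of `p^{m-1}` in `ℤ/p^m`. -/
theorem mul_pow_pred_eq_of_cast_eq (hm : 1 ≤ m) {x y : ZMod (p ^ m)}
    (h : (ZMod.castHom (dvd_pow_self p (by omega)) (ZMod p) x) =
      ZMod.castHom (dvd_pow_self p (by omega)) (ZMod p) y) :
    x * (p : ZMod (p ^ m)) ^ (m - 1) = y * (p : ZMod (p ^ m)) ^ (m - 1) := by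
  haveI : NeZero (p ^ m) := ⟨pow_ne_zero _ hp.out.ne_zero⟩
  rw [← sub_eq_zero, ← sub_mul]
  have h0 : ZMod.castHom (dvd_pow_self p (by omega)) (ZMod p) (x - y) = 0 := by
    rw [map_sub, h, sub_self]
  rw [← ZMod.natCast_zmod_val (x - y)] at h0 ⊢
  rw [map_natCast, ZMod.natCast_eq_zero_iff] at h0
  obtain ⟨k, hk⟩ := h0
  rw [hk, Nat.cast_mul, mul_comm (p : ZMod (p ^ m)) (k : ZMod (p ^ m)), mul_assoc,
    natCast_mul_pow_pred_eq_zero hm, mul_zero]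

/-- An element of the kernel of `ℤ/p^m → ℤ/p^{m-1}` is `1 + y·p^{m-1}`. -/
theorem exists_eq_one_add_mul_pow_pred {u : ZMod (p ^ m)}
    (hu : ZMod.castHom (pow_dvd_pow p (Nat.sub_le m 1)) (ZMod (p ^ (m - 1))) u = 1) :
    ∃ y : ZMod (p ^ m), u = 1 + y * (p : ZMod (p ^ m)) ^ (m - 1) := by
  haveI : NeZero (p ^ m) := ⟨pow_ne_zero _ hp.out.ne_zero⟩
  have h0 : ZMod.castHom (pow_dvd_pow p (Nat.sub_le m 1)) (ZMod (p ^ (m - 1))) (u - 1) = 0 := by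
    rw [map_sub, hu, map_one, sub_self]
  rw [← ZMod.natCast_zmod_val (u - 1), map_natCast, ZMod.natCast_eq_zero_iff] at h0
  obtain ⟨k, hk⟩ := h0
  refine ⟨k, ?_⟩
  rw [← sub_eq_iff_eq_add', ← ZMod.natCast_zmod_val (u - 1), hk, Nat.cast_mul, Nat.cast_pow,
    mul_comm]

/-- **The wild additive character of a Dirichlet character mod `p^m`, `m ≥ 2`**: on `ℤ/p`,
`ψ_κ(t) := κ(1 + t·p^{m−1})` (`t` represented in `[0, p)`); additive because
`(1 + s p^{m−1})(1 + t p^{m−1}) ≡ 1 + (s + t) p^{m−1} (mod p^m)` for `m ≥ 2`. The Gauss sum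
`τ(ε, ψ_κ)` of the module docstring of `TameBranchLower.lean` is `gaussSum ε ψ_κ`
(`tameGaussSum_eq_gaussSum`). [folklore] -/
def wildAddChar (hm : 2 ≤ m) (κ : DirichletCharacter ℂ_[p] (p ^ m)) : AddChar (ZMod p) ℂ_[p] where
  toFun t := κ (1 + ((t.val : ℕ) : ZMod (p ^ m)) * (p : ZMod (p ^ m)) ^ (m - 1))
  map_zero_eq_one' := by simp
  map_add_eq_mul' s t := by
    rw [← map_mul]
    congr 1
    have hst : (((s + t).val : ℕ) : ZMod (p ^ m)) * (p : ZMod (p ^ m)) ^ (m - 1) =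
        (((s.val : ℕ) : ZMod (p ^ m)) + ((t.val : ℕ) : ZMod (p ^ m))) *
          (p : ZMod (p ^ m)) ^ (m - 1) := by
      apply mul_pow_pred_eq_of_cast_eq (by omega)
      rw [map_add, map_natCast, map_natCast, map_natCast, ZMod.natCast_zmod_val,
        ZMod.natCast_zmod_val, ZMod.natCast_zmod_val]
    rw [hst]
    calc (1 : ZMod (p ^ m)) + (((s.val : ℕ) : ZMod (p ^ m)) + ((t.val : ℕ) : ZMod (p ^ m))) *
          (p : ZMod (p ^ m)) ^ (m - 1)
        = (1 + ((s.val : ℕ) : ZMod (p ^ m)) * (p : ZMod (p ^ m)) ^ (m - 1)) *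
            (1 + ((t.val : ℕ) : ZMod (p ^ m)) * (p : ZMod (p ^ m)) ^ (m - 1)) -
          ((s.val : ℕ) : ZMod (p ^ m)) * ((t.val : ℕ) : ZMod (p ^ m)) *
            ((p : ZMod (p ^ m)) ^ (m - 1) * (p : ZMod (p ^ m)) ^ (m - 1)) := by ring
      _ = _ := by rw [pow_pred_mul_pow_pred_eq_zero hm, mul_zero, sub_zero]

/-- Unfolding `ψ_κ(t) = κ(1 + t·p^{m−1})` (`t` represented in `[0, p)`). [folklore] -/
theorem wildAddChar_apply (hm : 2 ≤ m) (κ : DirichletCharacter ℂ_[p] (p ^ m)) (t : ZMod p) :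
    wildAddChar hm κ t = κ (1 + ((t.val : ℕ) : ZMod (p ^ m)) * (p : ZMod (p ^ m)) ^ (m - 1)) :=
  rfl

/-- `ψ_κ(y mod p) = κ(1 + y·p^{m−1})` for every `y ∈ ℤ/p^m`. [folklore] -/
theorem wildAddChar_apply_castHom (hm : 2 ≤ m) (κ : DirichletCharacter ℂ_[p] (p ^ m))
    (y : ZMod (p ^ m)) :
    wildAddChar hm κ (ZMod.castHom (dvd_pow_self p (by omega)) (ZMod p) y) =
      κ (1 + y * (p : ZMod (p ^ m)) ^ (m - 1)) := by
  rw [wildAddChar_apply]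
  congr 2
  apply mul_pow_pred_eq_of_cast_eq (by omega)
  rw [map_natCast, ZMod.natCast_zmod_val]

/-- `τ(ε, ψ_κ) = gaussSum ε ψ_κ`. [folklore] -/
theorem tameGaussSum_eq_gaussSum (hm : 2 ≤ m) (ε : DirichletCharacter ℂ_[p] p)
    (κ : DirichletCharacter ℂ_[p] (p ^ m)) :
    tameGaussSum p ε κ = gaussSum ε (wildAddChar hm κ) :=
  rfl

/-- **`ψ_κ` is nontrivial for `κ` PRIMITIVE of conductor `p^m`**: otherwise `κ` is trivial on the
kernel `{1 + y p^{m−1}}` of `(ℤ/p^m)ˣ → (ℤ/p^{m−1})ˣ`, so `κ` factors through `p^{m−1}`. [folklore] -/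
theorem wildAddChar_ne_one (hm : 2 ≤ m) {κ : DirichletCharacter ℂ_[p] (p ^ m)}
    (hκ : κ.IsPrimitive) : wildAddChar hm κ ≠ 1 := by
  haveI : NeZero (p ^ m) := ⟨pow_ne_zero _ hp.out.ne_zero⟩
  intro h1
  have hlt : p ^ (m - 1) < p ^ m := Nat.pow_lt_pow_right hp.out.one_lt (by omega)
  refine not_factorsThrough_of_isPrimitive hκ hlt ?_
  rw [DirichletCharacter.factorsThrough_iff_ker_unitsMap (pow_dvd_pow p (Nat.sub_le m 1)),
    SetLike.le_def]
  intro u hu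
  rw [MonoidHom.mem_ker] at hu ⊢
  have hcast : ZMod.castHom (pow_dvd_pow p (Nat.sub_le m 1)) (ZMod (p ^ (m - 1)))
      (u : ZMod (p ^ m)) = 1 := by
    have h := congr_arg Units.val hu
    rwa [ZMod.unitsMap_def, Units.coe_map, Units.val_one] at h
  obtain ⟨y, hy⟩ := exists_eq_one_add_mul_pow_pred hcast
  have hκu : κ (u : ZMod (p ^ m)) = 1 := by
    rw [hy, ← wildAddChar_apply_castHom hm κ y, h1, AddChar.one_apply]
  ext
  rw [MulChar.coe_toUnitHom, hκu, Units.val_one]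

/-- `ψ_κ` is a primitive additive character of the field `ℤ/p` (`κ` primitive, `m ≥ 2`). -/
theorem isPrimitive_wildAddChar (hm : 2 ≤ m) {κ : DirichletCharacter ℂ_[p] (p ^ m)}
    (hκ : κ.IsPrimitive) : (wildAddChar hm κ).IsPrimitive :=
  AddChar.IsPrimitive.of_ne_one (wildAddChar_ne_one hm hκ)

/-- `ε(−1)² = 1`, so `ε(−1)⁻¹ = ε(−1)` and `ε⁻¹(−1) = ε(−1)`. -/
theorem apply_neg_one_mul_apply_neg_one (ε : DirichletCharacter ℂ_[p] p) : ε (-1) * ε (-1) = 1 := by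
  rw [← map_mul, neg_mul_neg, one_mul, map_one]

/-- **`τ(ε, ψ_κ) · τ(ε̄, ψ_κ) = ε(−1) · p`** for `ε ≠ 1` and `κ` primitive mod `p^m`, `m ≥ 2`
(Mathlib `gaussSum_mul_gaussSum_eq_card` + `mul_gaussSum_inv_eq_gaussSum`). [folklore] -/
theorem tameGaussSum_mul_tameGaussSum_inv (hm : 2 ≤ m) {ε : DirichletCharacter ℂ_[p] p}
    (hε : ε ≠ 1) {κ : DirichletCharacter ℂ_[p] (p ^ m)} (hκ : κ.IsPrimitive) :
    tameGaussSum p ε κ * tameGaussSum p ε⁻¹ κ = ε (-1) * p := by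
  rw [tameGaussSum_eq_gaussSum hm, tameGaussSum_eq_gaussSum hm]
  set ψ := wildAddChar hm κ
  have hcard := gaussSum_mul_gaussSum_eq_card hε (isPrimitive_wildAddChar hm hκ)
  rw [ZMod.card p] at hcard
  have hinv : gaussSum ε⁻¹ ψ = ε (-1) * gaussSum ε⁻¹ ψ⁻¹ := by
    rw [← mul_gaussSum_inv_eq_gaussSum ε⁻¹ ψ, MulChar.inv_apply', inv_neg_one]
  rw [hinv, mul_left_comm, hcard]

/-- Units of `ℤ/p^m` are the classes prime to `p` (`1 ≤ m`). [folklore] -/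
theorem isUnit_iff_isUnit_cast (hm : 1 ≤ m) (b : ZMod (p ^ m)) :
    IsUnit b ↔ IsUnit (ZMod.castHom (dvd_pow_self p (by omega)) (ZMod p) b) := by
  haveI : NeZero (p ^ m) := ⟨pow_ne_zero _ hp.out.ne_zero⟩
  have h1 : ZMod.castHom (dvd_pow_self p (by omega)) (ZMod p) b = ((b.val : ℕ) : ZMod p) := by
    rw [ZMod.castHom_apply, ZMod.cast_eq_val]
  rw [h1]
  conv_lhs => rw [← ZMod.natCast_zmod_val b]
  rw [ZMod.isUnit_iff_coprime, ZMod.isUnit_iff_coprime, Nat.coprime_pow_right_iff (by omega)]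

end WildLevel

/-! ### §2 The twisted symbol sum of `x = τ_{χ⁻¹} Φ` against a wild character: un-twisting -/

section Untwist

variable {p : ℕ} [hp : Fact p.Prime] {m : ℕ}

/-- Carry: `b/p^m + c/p = (b + c p^{m−1}) / p^m ≡ (class of b + c p^{m−1}).val / p^m (mod 1)`. -/
theorem exists_div_add_div_eq (hm : 1 ≤ m) (b : ZMod (p ^ m)) (c : ZMod p) :
    ∃ q : ℕ, (b.val : ℚ) / (p : ℚ) ^ m + (c.val : ℚ) / p =
      (((b + ((c.val * p ^ (m - 1) : ℕ) : ZMod (p ^ m))).val : ℚ)) / (p : ℚ) ^ m + q := by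
  haveI : NeZero (p ^ m) := ⟨pow_ne_zero _ hp.out.ne_zero⟩
  have hp0 : (p : ℚ) ≠ 0 := Nat.cast_ne_zero.mpr hp.out.ne_zero
  set n : ℕ := b.val + c.val * p ^ (m - 1) with hn
  have hcls : b + ((c.val * p ^ (m - 1) : ℕ) : ZMod (p ^ m)) = (n : ZMod (p ^ m)) := by
    rw [hn, Nat.cast_add, ZMod.natCast_zmod_val]
  refine ⟨n / p ^ m, ?_⟩
  rw [hcls, ZMod.val_natCast]
  have hdiv : (n : ℚ) = ((n % p ^ m : ℕ) : ℚ) + (p : ℚ) ^ m * ((n / p ^ m : ℕ) : ℚ) := by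
    exact_mod_cast (Nat.mod_add_div n (p ^ m)).symm
  have hpm : (p : ℚ) ^ m = (p : ℚ) ^ (m - 1) * p := by
    rw [← pow_succ, Nat.sub_add_cancel hm]
  have hlhs : (b.val : ℚ) / (p : ℚ) ^ m + (c.val : ℚ) / p = (n : ℚ) / (p : ℚ) ^ m := by
    rw [hn, hpm]
    push_cast
    field_simp
  rw [hlhs, hdiv]
  field_simp

/-- **Un-twisting the wild symbol sum.** For `x = τ_{χ⁻¹} Φ` (`Φ` `1`-periodic) and `κ` PRIMITIVE
mod `p^m`, `m ≥ 2`: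
`∑_{b mod p^m} κ(b) x(b/p^m) = ε(−1) · τ(ε̄, ψ_κ) · ∑_{a mod p^m} κ(a) ε̄(a) Φ(a/p^m)`
(`ε = ι ∘ χ` the `ℂ_p`-valued copy of `χ`): substitute `a = b + c p^{m−1}`, use
`κ(a − c p^{m−1}) = κ(a) ψ_κ(−c/a)` on units (both sides vanish on non-units) and
`∑_c ε̄(c) ψ_κ(−c/a) = ε(−1) ε̄(a) τ(ε̄, ψ_κ)` (`gaussSum_mulShift_eq`). [folklore] -/
theorem sum_mul_twist_eq (hm : 2 ≤ m) (χ : MulChar (ZMod p) ℚ_[p]) {Φ x : ℚ → ℚ_[p]}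
    (hper : ∀ s, Φ (s + 1) = Φ s)
    (hx : ∀ s, x s = ∑ c : ZMod p, χ⁻¹ c * Φ (s + (c.val : ℚ) / p))
    (κ : DirichletCharacter ℂ_[p] (p ^ m)) :
    ∑ b : ZMod (p ^ m), κ b * algebraMap ℚ_[p] ℂ_[p] (x ((b.val : ℚ) / (p : ℚ) ^ m)) =
      (χ.ringHomComp (algebraMap ℚ_[p] ℂ_[p])) (-1) *
        tameGaussSum p (χ.ringHomComp (algebraMap ℚ_[p] ℂ_[p]))⁻¹ κ *
        ∑ a : ZMod (p ^ m), κ a * algebraMap ℚ_[p] ℂ_[p] (χ⁻¹ ((a.val : ℕ) : ZMod p)) *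
          algebraMap ℚ_[p] ℂ_[p] (Φ ((a.val : ℚ) / (p : ℚ) ^ m)) := by
  haveI : NeZero (p ^ m) := ⟨pow_ne_zero _ hp.out.ne_zero⟩
  set ι : ℚ_[p] →+* ℂ_[p] := algebraMap ℚ_[p] ℂ_[p] with hι
  set ε : MulChar (ZMod p) ℂ_[p] := χ.ringHomComp ι with hε
  set P : ZMod (p ^ m) := (p : ZMod (p ^ m)) ^ (m - 1) with hP
  set ψ := wildAddChar hm κ with hψ
  -- the shift classes `n c = c · p^{m-1}`
  set n : ZMod p → ZMod (p ^ m) := fun c ↦ ((c.val * p ^ (m - 1) : ℕ) : ZMod (p ^ m)) with hn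
  have hnP : ∀ c : ZMod p, n c = ((c.val : ℕ) : ZMod (p ^ m)) * P := by
    intro c; simp only [hn, hP, Nat.cast_mul, Nat.cast_pow]
  have hn_cast : ∀ c : ZMod p, ZMod.castHom (dvd_pow_self p (by omega)) (ZMod p) (n c) = 0 := by
    intro c
    rw [hnP, map_mul, map_pow, map_natCast, map_natCast, ← Nat.sub_add_cancel (by omega : 1 ≤ m - 1),
      pow_succ, ZMod.natCast_self, mul_zero, mul_zero]
  have hεinv : ε⁻¹ = χ⁻¹.ringHomComp ι := MulChar.ringHomComp_inv χ ι
  -- Step A/B: expand `x` and absorb the shift into the class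
  have hAB : ∀ b : ZMod (p ^ m), ι (x ((b.val : ℚ) / (p : ℚ) ^ m)) =
      ∑ c : ZMod p, ι (χ⁻¹ c) * ι (Φ (((b + n c).val : ℚ) / (p : ℚ) ^ m)) := by
    intro b
    rw [hx, map_sum]
    refine Finset.sum_congr rfl fun c _ ↦ ?_
    rw [map_mul]
    obtain ⟨q, hq⟩ := exists_div_add_div_eq (by omega : 1 ≤ m) b c
    rw [hq, CensusX43.periodic_natCast hper]
  simp_rw [hAB, Finset.mul_sum]
  -- Step C: swap and reindex `a = b + n c`
  rw [Finset.sum_comm]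
  have hC : ∀ c : ZMod p,
      ∑ b : ZMod (p ^ m), κ b * (ι (χ⁻¹ c) * ι (Φ (((b + n c).val : ℚ) / (p : ℚ) ^ m))) =
        ∑ a : ZMod (p ^ m), κ (a - n c) * (ι (χ⁻¹ c) * ι (Φ ((a.val : ℚ) / (p : ℚ) ^ m))) := by
    intro c
    exact Fintype.sum_equiv (Equiv.addRight (n c)) _ _ fun b ↦ by
      simp only [Equiv.coe_addRight, add_sub_cancel_right]
  simp_rw [hC]
  rw [Finset.sum_comm]
  -- Step D: the inner character sum
  have hD : ∀ a : ZMod (p ^ m), ∑ c : ZMod p, κ (a - n c) * ι (χ⁻¹ c) =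
      κ a * (ε (-1) * ε⁻¹ ((a.val : ℕ) : ZMod p)) * tameGaussSum p ε⁻¹ κ := by
    intro a
    by_cases ha : IsUnit a
    · obtain ⟨u, rfl⟩ := ha
      set ū : (ZMod p)ˣ := Units.map (ZMod.castHom (dvd_pow_self p (by omega)) (ZMod p)).toMonoidHom u
        with hū
      have hūval : (ū : ZMod p) = (((u : ZMod (p ^ m)).val : ℕ) : ZMod p) := by
        rw [hū, Units.coe_map, RingHom.toMonoidHom_eq_coe, MonoidHom.coe_coe, ZMod.castHom_apply,
          ZMod.cast_eq_val]
      have hterm : ∀ c : ZMod p, κ ((u : ZMod (p ^ m)) - n c) =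
          κ (u : ZMod (p ^ m)) * ψ (((-ū⁻¹ : (ZMod p)ˣ) : ZMod p) * c) := by
        intro c
        have hfac : (u : ZMod (p ^ m)) - n c =
            (u : ZMod (p ^ m)) * (1 + (-(↑u⁻¹ : ZMod (p ^ m)) * ((c.val : ℕ) : ZMod (p ^ m))) * P) := by
          rw [hnP]
          have hu1 : (u : ZMod (p ^ m)) * (↑u⁻¹ : ZMod (p ^ m)) = 1 := Units.mul_inv u
          linear_combination (((c.val : ℕ) : ZMod (p ^ m)) * P) * hu1
        rw [hfac, map_mul, ← wildAddChar_apply_castHom hm κ]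
        congr 2
        rw [map_mul, map_neg, map_natCast, ZMod.natCast_zmod_val, Units.val_neg, Units.coe_map_inv,
          RingHom.toMonoidHom_eq_coe, MonoidHom.coe_coe]
      simp_rw [hterm]
      have hG : ∑ c : ZMod p, κ (u : ZMod (p ^ m)) * ψ (((-ū⁻¹ : (ZMod p)ˣ) : ZMod p) * c) * ι (χ⁻¹ c) =
          κ (u : ZMod (p ^ m)) * gaussSum ε⁻¹ (ψ.mulShift ((-ū⁻¹ : (ZMod p)ˣ) : ZMod p)) := by
        rw [gaussSum, Finset.mul_sum]
        refine Finset.sum_congr rfl fun c _ ↦ ?_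
        rw [AddChar.mulShift_apply, hεinv, MulChar.ringHomComp_apply]
        ring
      rw [hG, gaussSum_mulShift_eq, inv_inv, tameGaussSum_eq_gaussSum hm, Units.val_neg,
        ← neg_one_mul ((ū⁻¹ : (ZMod p)ˣ) : ZMod p), map_mul, Units.val_inv_eq_inv_val,
        ← MulChar.inv_apply', hūval]
      ring
    · have hκa : κ a = 0 := κ.map_nonunit ha
      have hκ0 : ∀ c : ZMod p, κ (a - n c) = 0 := by
        intro c
        apply κ.map_nonunit
        rw [isUnit_iff_isUnit_cast (by omega : 1 ≤ m), map_sub, hn_cast, sub_zero,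
          ← isUnit_iff_isUnit_cast (by omega : 1 ≤ m)]
        exact ha
      simp [hκ0, hκa]
  have hD' : ∀ a : ZMod (p ^ m),
      ∑ c : ZMod p, κ (a - n c) * (ι (χ⁻¹ c) * ι (Φ ((a.val : ℚ) / (p : ℚ) ^ m))) =
        ε (-1) * tameGaussSum p ε⁻¹ κ *
          (κ a * ι (χ⁻¹ ((a.val : ℕ) : ZMod p)) * ι (Φ ((a.val : ℚ) / (p : ℚ) ^ m))) := by
    intro a
    have h := hD a
    have hεa : ε⁻¹ ((a.val : ℕ) : ZMod p) = ι (χ⁻¹ ((a.val : ℕ) : ZMod p)) := by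
      rw [hεinv, MulChar.ringHomComp_apply]
    rw [hεa] at h
    have hsplit : ∑ c : ZMod p, κ (a - n c) * (ι (χ⁻¹ c) * ι (Φ ((a.val : ℚ) / (p : ℚ) ^ m))) =
        (∑ c : ZMod p, κ (a - n c) * ι (χ⁻¹ c)) * ι (Φ ((a.val : ℚ) / (p : ℚ) ^ m)) := by
      rw [Finset.sum_mul]
      exact Finset.sum_congr rfl fun c _ ↦ by ring
    rw [hsplit, h]
    ring
  simp_rw [hD']

end Untwist

end Summit.BirchSwinnertonDyer.Rank1Residual.Additive

end
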